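import Summits.QuantumFields.BalabanUV.T4Continuum.Support.VariationalCovariantEffective
import Summits.QuantumFields.BalabanUV.T4Continuum.Support.VariationalTower

/-!
# T⁴ programme, spine node NE2 (U1a), lane P2 — COMP⁺ AND THE k-INDEXED TOWER INSTANTIATION of the variational route's background tier:
# the composite transported average `Q_T ∘ Q_{T′} = Q_{T″}` read through the block nesting `fine L (fine n M) ≃ fine (n·L) M`, the
# transport of the fine covariant form, and `OneStepAveragedLaw (fun _ ↦ 1) 1 (k ↦ X_k) e` for the scalar covariant species MODULO the
# per-level additive brackets (`t4/skeletons/NE2-t4-ne2-p2.md` v0.7 §7 «bookkeeping owed: the k-indexed tower instantiation …, COMP⁺»;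
# cell `pub-balaban`, NE2 formalisation swarm, unit `b2b-balaban-t4-ne2-formalise-leaf-02` gen 3, supplier to lineage t4-ne2-p2)

HONEST FRAMING (T4-DAG p. 1).  Rung (B)+1 only — NOT infinite volume, NOT a mass gap, NOT Clay.  Node NE2 is NOT IN PRINT and NOT
proved here.  MODEL LEVEL: U(1) bond phases and site transports are DATA; scalar (0-form) sector; OUR statements — block bookkeeping and
finite-dimensional linear algebra ([folklore]); the leaves ONE⁺/REG⁺ (and the per-level brackets they feed) are NOT touched: they enter as
HYPOTHESES of exactly the conclusion shape of `VariationalCovariantScalarPair.scalar_pair_bracket`.  Nothing printed is a hypothesis; no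
`def … : Prop` fact; no `sorry`; axioms standard.  HONEST DEPENDENCY (cell, verbatim): continuum YM on T⁴ ⇐ BetaPertH ∧ nine spine estimates
(0/9 proved); BetaPertH ⇐ (D1) ∧ (D4) ∧ CAP+tail; G-an2-4 gates asym, D1 and NE2/3/4.

CONTENTS.
* §1 COMP⁺ (skeleton §2.C «`Q_k(T) ∘ Q₁(T′) = Q′_{k+1}` with composite transports `T″(x′) = T(x(x′))·T′(x′)`», [B9] (3.15)/(3.19)
  SHAPE): `compT n L M T T′ : Tor (fine (n·L) M) → ℂ` (unimodular with `T`, `T′`: `norm_compT`) and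
  **`Qk_comp_Q1_apply : (Qk n M T ∘ Q1 n L M T′) f′ = Qk (n·L) M (compT T T′) (f′ ∘ sites n L M)`** — the tree's (1.16)–(1.18)
  certificate `B5Composition116.bpt_bpt` / `sum_J` with transports inserted.
* §2 transport of the fine objects along `sites n L M : Tor (fine (n·L) M) ≃ Tor (fine L (fine n M))`: `Rtr n L M R′ := R′ ∘ sites`,
  `dirU_transport`, **`Sf_eq_transport : Sf n L M R′ f′ = Sc (n·L) M (Rtr R′) (f′ ∘ sites)`**, `nsq_transport`, `qV_eq_transport`,
  `coercive_transport` (leaf P⁺'s shape passes to the composite data).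
* §3 **`blockSpin_pair_transport : blockSpin (Qk n M T ∘ Q1 n L M T′) (Sf n L M R′) μ = blockSpin (Qk (n·L) M (compT T T′)) (Sc (n·L) M (Rtr R′)) μ`**
  (`VariationalTower.blockSpin_equiv`): the FINE member of the canonical pair at level `n` IS the COARSE block-spin value at level `n·L` on the
  composite/transported data; hence `bracket_transport` and **`effSf_eq_effSc : effSf n L M R′ T T′ a = effSc (n·L) M (Rtr R′) (compT T T′) a`**;
  and in TOWER SHAPE (`Q1tow n L M T′ g := Q1 (g ∘ sites⁻¹) : (level n·L fields) → (level n fields)`): `Qk_compT_eq_comp : Qk (n·L) (compT T T′) =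
  Qk n T ∘ Q1tow T′` (= the `hcomp` of `VariationalCovariantUpper.ub_tower`), `Sc_Rtr_eq`, `blockSpin_Q1tow` (its `hONE` slot reads the pair's ONE⁺).
* §4 THE TOWER: data `Rc k`, unimodular `T k` on `Tor (fine (L^k) M)`, `X k := effSc (L^k) M (Rc k) (T k) a` (Hermitian, `VariationalCovariantEffective`);
  **`oneStepAveragedLaw_effSc`**: per-level leaf-P⁺-shaped coercivity + per-level additive brackets between consecutive block-spin values ⟹
  `OneStepAveragedLaw (fun _ ↦ 1) 1 X (k ↦ max (e k) (e′ k))` (row NE2's wall SHAPE for the scalar covariant species); **`towerLimitRate_effSc`**: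
  geometric brackets `C·ρ^k` ⟹ `TowerLimitRate (fun _ ↦ 1) 1 X C ρ` (the η-rate currency: `X_k` converges, `‖X_k − X_∞‖ ≤ Cρ^k/(1−ρ)`); and
  **`oneStepAveragedLaw_effSc_of_pairs`**: the same from brackets in `scalar_pair_bracket`'s canonical-pair form at `n = L^k` plus the COMP⁺ data
  identities `T (k+1) = compT (T k) (T′ k)`, `Rc (k+1) = Rtr (R′ k)` (DISPLAYED; `L^(k+1) = L^k·L` by `rfl`).  Nothing of NE3.
-/

noncomputable section

open scoped Matrix ComplexConjugate ComplexOrder Matrix.Norms.L2Operator BigOperators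

namespace Summit.QuantumFields.BalabanUV.T4Continuum.VariationalCovariantTower

open Summit.QuantumFields.BalabanUV.T4Continuum.VariationalTransfer (blockSpin)
open Summit.QuantumFields.BalabanUV.T4Continuum.VariationalTower (blockSpin_equiv sites_unitVec)
open Summit.QuantumFields.BalabanUV.T4Continuum.VariationalEffectiveOperator
open Summit.QuantumFields.BalabanUV.T4Continuum.VariationalCovariantEffective
open Summit.QuantumFields.BalabanUV.T4Continuum.VariationalAdditive (oneStepAveragedLaw_of_forms)
open Summit.QuantumFields.BalabanUV.T4Continuum.CovariantAveragingTower (OneStepAveragedLaw TowerLimitRate towerLimitRate_of_oneStepAveragedLaw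
  opNorm_one_le)
open Literature.MathematicalPhysics.QuantumFieldTheory.Balaban1983to89.B5Prop11Lower (nsq nsq_nonneg)
open Literature.MathematicalPhysics.QuantumFieldTheory.Balaban1983to89.B5Prop11Plancherel (Tor fine unitVec)
open Literature.MathematicalPhysics.QuantumFieldTheory.Balaban1983to89.B5Block118 (bpt)
open Literature.MathematicalPhysics.QuantumFieldTheory.Balaban1983to89.B5Blocks16 (blockOf blockOf_bpt)
open Literature.MathematicalPhysics.QuantumFieldTheory.Balaban1983to89.B5Composition116 (sites bpt_bpt sum_J J fine_fine recast_add)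
open Summit.QuantumFields.BalabanUV.T4Continuum.VariationalCovariantFederbush (cD dirU Qc)
open Summit.QuantumFields.BalabanUV.T4Continuum.VariationalCovariantScalarPair (Sc Sf qW qV Qk Q1)

variable {d : ℕ} (n L : ℕ) [NeZero n] [NeZero L] (M : Fin d → ℕ) [hM : ∀ μ, NeZero (M μ)]

/-! ## §1 COMP⁺: the composite transported average -/

/-- the COMPOSITE site transports `T″(x′) = T(block of x′)·T′(x′)` on the `n·L`-fine torus, read through `sites` ([B9] (3.15)/(3.19) SHAPE,
abelian; transports as data). [folklore] -/
def compT (T : Tor (fine n M) → ℂ) (T' : Tor (fine L (fine n M)) → ℂ) (x : Tor (fine (n * L) M)) : ℂ :=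
  T (blockOf L (fine n M) (sites n L M x)) * T' (sites n L M x)

/-- composite transports of unimodular transports are unimodular. [folklore] -/
theorem norm_compT {T : Tor (fine n M) → ℂ} (hT : ∀ x, ‖T x‖ = 1) {T' : Tor (fine L (fine n M)) → ℂ} (hT' : ∀ x, ‖T' x‖ = 1)
    (x : Tor (fine (n * L) M)) : ‖compT n L M T T' x‖ = 1 := by
  rw [compT, norm_mul, hT, hT', one_mul]

/-- **COMP⁺**: `(Q_T ∘ Q_{T′}) f′ = Q_{T″} (f′ ∘ sites)` — averaging the one-step transported averages over the `n`-blocks is the `n·L`-block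
transported average with the composite transports (the tree's (1.16)–(1.18) certificate `bpt_bpt`/`sum_J`, transports inserted). [folklore] -/
theorem Qk_comp_Q1_apply (T : Tor (fine n M) → ℂ) (T' : Tor (fine L (fine n M)) → ℂ) (f' : Tor (fine L (fine n M)) → ℂ) :
    (Qk n M T ∘ Q1 n L M T') f' = Qk (n * L) M (compT n L M T T') (f' ∘ sites n L M) := by
  funext z
  simp only [Function.comp_apply, Qk, Q1, Qc]
  rw [← sum_J n L (fun Jx => compT n L M T T' (bpt (n * L) M z Jx) * f' (sites n L M (bpt (n * L) M z Jx)))]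
  simp_rw [compT, ← bpt_bpt, blockOf_bpt]
  have hscal : (((n * L : ℕ) : ℂ) ^ d)⁻¹ = ((n : ℂ) ^ d)⁻¹ * ((L : ℂ) ^ d)⁻¹ := by
    push_cast; rw [mul_pow, mul_inv]
  rw [hscal]
  simp only [Finset.mul_sum]
  refine Finset.sum_congr rfl fun j _ => Finset.sum_congr rfl fun i _ => ?_
  ring

/-- COMP⁺ as an identity of maps. [folklore] -/
theorem Qk_comp_Q1_eq (T : Tor (fine n M) → ℂ) (T' : Tor (fine L (fine n M)) → ℂ) :
    Qk n M T ∘ Q1 n L M T' = fun f' => Qk (n * L) M (compT n L M T T') (f' ∘ sites n L M) :=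
  funext (Qk_comp_Q1_apply n L M T T')

/-! ## §2 Transport of the fine objects along the block nesting `sites` -/

/-- the fine bond phases read on the `n·L`-fine torus. [folklore] -/
def Rtr (R' : Tor (fine L (fine n M)) → Fin d → ℂ) (x : Tor (fine (n * L) M)) (μ : Fin d) : ℂ := R' (sites n L M x) μ

omit [NeZero n] [NeZero L] hM in
/-- `sites` is additive. [folklore] -/
theorem sites_add (x y : Tor (fine (n * L) M)) : sites n L M (x + y) = sites n L M x + sites n L M y := by
  unfold sites; exact recast_add (fine_fine n L M) x y

/-- the covariant Dirichlet sums are transported: `dirU_{n·L}(R′∘sites)(f′∘sites) = dirU(R′)(f′)`. [folklore] -/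
theorem dirU_transport (R' : Tor (fine L (fine n M)) → Fin d → ℂ) (f' : Tor (fine L (fine n M)) → ℂ) (μ : Fin d) :
    dirU (fine (n * L) M) (Rtr n L M R') (f' ∘ sites n L M) μ = dirU (fine L (fine n M)) R' f' μ := by
  unfold dirU cD Rtr
  simp_rw [Function.comp_apply, sites_add, sites_unitVec]
  exact Equiv.sum_comp (sites n L M) (fun y => ‖R' y μ * f' (y + unitVec (fine L (fine n M)) μ) - f' y‖ ^ 2)

/-- the `ℓ²` masses are transported. [folklore] -/
theorem nsq_transport (f' : Tor (fine L (fine n M)) → ℂ) : nsq (f' ∘ sites n L M) = nsq f' := by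
  unfold nsq
  exact Equiv.sum_comp (sites n L M) (fun y => ‖f' y‖ ^ 2)

/-- **the fine covariant form IS the level-`n·L` coarse form on the transported data**: `Sf n L M R′ f′ = Sc (n·L) M (R′∘sites) (f′∘sites)`.
[folklore] -/
theorem Sf_eq_transport (R' : Tor (fine L (fine n M)) → Fin d → ℂ) (f' : Tor (fine L (fine n M)) → ℂ) :
    Sf n L M R' f' = Sc (n * L) M (Rtr n L M R') (f' ∘ sites n L M) := by
  unfold Sf Sc
  simp_rw [dirU_transport]
  push_cast
  ring

/-- the `L²` sizes agree: `qV n L M f′ = qW (n·L) M (f′ ∘ sites)`. [folklore] -/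
theorem qV_eq_transport (f' : Tor (fine L (fine n M)) → ℂ) : qV n L M f' = qW (n * L) M (f' ∘ sites n L M) := by
  unfold qV qW
  rw [nsq_transport]
  push_cast
  ring

/-- leaf P⁺'s coercivity SHAPE passes from the canonical-pair presentation to the composite/transported data at level `n·L`. [folklore] -/
theorem coercive_transport {R' : Tor (fine L (fine n M)) → Fin d → ℂ} {T : Tor (fine n M) → ℂ} {T' : Tor (fine L (fine n M)) → ℂ}
    {CP : ℝ} (hPf : ∀ f', qV n L M f' ≤ CP * (Sf n L M R' f' + nsq (Qk n M T (Q1 n L M T' f')))) (g : Tor (fine (n * L) M) → ℂ) :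
    qW (n * L) M g ≤ CP * (Sc (n * L) M (Rtr n L M R') g + nsq (Qk (n * L) M (compT n L M T T') g)) := by
  have hg : g = (g ∘ (sites n L M).symm) ∘ sites n L M := by
    funext x; simp
  have h := hPf (g ∘ (sites n L M).symm)
  rw [qV_eq_transport, Sf_eq_transport, ← hg] at h
  have hc : Qk n M T (Q1 n L M T' (g ∘ (sites n L M).symm)) = Qk (n * L) M (compT n L M T T') g := by
    have := Qk_comp_Q1_apply n L M T T' (g ∘ (sites n L M).symm)
    rw [Function.comp_apply, ← hg] at this
    exact this
  rw [hc] at h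
  exact h

/-! ## §3 The fine member of the canonical pair as a coarse object at level `n·L` -/

/-- **`blockSpin (Q_T ∘ Q_{T′}) Sf = blockSpin Q_{T″} Sc_{n·L}` on the transported data** (`VariationalTower.blockSpin_equiv` along
`f′ ↦ f′ ∘ sites`). [folklore] -/
theorem blockSpin_pair_transport (T : Tor (fine n M) → ℂ) (T' : Tor (fine L (fine n M)) → ℂ) (R' : Tor (fine L (fine n M)) → Fin d → ℂ)
    (μ : Tor M → ℂ) :
    blockSpin (Qk n M T ∘ Q1 n L M T') (Sf n L M R') μ
      = blockSpin (Qk (n * L) M (compT n L M T T')) (Sc (n * L) M (Rtr n L M R')) μ := by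
  symm
  refine blockSpin_equiv ((sites n L M).symm.arrowCongr (Equiv.refl ℂ)) (fun f' => ?_) (fun f' => ?_) μ
  · have harr : (sites n L M).symm.arrowCongr (Equiv.refl ℂ) f' = f' ∘ sites n L M := by
      funext x; simp [Equiv.arrowCongr_apply]
    rw [harr, Qk_comp_Q1_apply]
  · have harr : (sites n L M).symm.arrowCongr (Equiv.refl ℂ) f' = f' ∘ sites n L M := by
      funext x; simp [Equiv.arrowCongr_apply]
    rw [harr, Sf_eq_transport]

/-- the canonical-pair bracket in the level-`n·L` coarse presentation. [folklore] -/
theorem bracket_transport {Rc : Tor (fine n M) → Fin d → ℂ} {R' : Tor (fine L (fine n M)) → Fin d → ℂ} {T : Tor (fine n M) → ℂ}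
    {T' : Tor (fine L (fine n M)) → ℂ} {e e' : ℝ} {μ : Tor M → ℂ}
    (hbr : blockSpin (Qk n M T) (Sc n M Rc) μ ≤ blockSpin (Qk n M T ∘ Q1 n L M T') (Sf n L M R') μ + e * nsq μ ∧
      blockSpin (Qk n M T ∘ Q1 n L M T') (Sf n L M R') μ ≤ blockSpin (Qk n M T) (Sc n M Rc) μ + e' * nsq μ) :
    blockSpin (Qk n M T) (Sc n M Rc) μ ≤ blockSpin (Qk (n * L) M (compT n L M T T')) (Sc (n * L) M (Rtr n L M R')) μ + e * nsq μ ∧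
      blockSpin (Qk (n * L) M (compT n L M T T')) (Sc (n * L) M (Rtr n L M R')) μ ≤ blockSpin (Qk n M T) (Sc n M Rc) μ + e' * nsq μ := by
  rw [← blockSpin_pair_transport]; exact hbr

/-- **`X_{k+1}(U′)` in the two presentations agree**: `effSf n L M R′ T T′ a = effSc (n·L) M (R′∘sites) (T″) a` (Hermitian matrices with
equal forms). [folklore] -/
theorem effSf_eq_effSc {R' : Tor (fine L (fine n M)) → Fin d → ℂ} {T : Tor (fine n M) → ℂ} (hT : ∀ x, ‖T x‖ = 1)
    {T' : Tor (fine L (fine n M)) → ℂ} (hT' : ∀ x, ‖T' x‖ = 1) {CP a : ℝ}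
    (hPf : ∀ f', qV n L M f' ≤ CP * (Sf n L M R' f' + nsq (Qk n M T (Q1 n L M T' f')))) (ha : 0 < a) :
    effSf n L M R' T T' a = effSc (n * L) M (Rtr n L M R') (compT n L M T T') a := by
  refine eq_of_forms_eq (effSf_isHermitian n L M hT hT' hPf ha)
    (effSc_isHermitian (n * L) M (norm_compT n L M hT hT') (coercive_transport n L M hPf) ha) fun μ => ?_
  rw [← blockSpin_Sf_eq n L M hT hT' hPf ha μ, ← blockSpin_Sc_eq (n * L) M (norm_compT n L M hT hT') (coercive_transport n L M hPf) ha μ,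
    blockSpin_pair_transport]

/-! ### the one-step average as a map between consecutive tower levels (the `Q₁ k : W (k+1) → W k` of `VariationalCovariantUpper.ub_tower`) -/

/-- the one-step transported average from level-`n·L` fields (on `Tor (fine (n·L) M)`) to level-`n` fields: `Q₁ g := Q_{T′} (g ∘ sites⁻¹)`.
[folklore] -/
def Q1tow (T' : Tor (fine L (fine n M)) → ℂ) (g : Tor (fine (n * L) M) → ℂ) : Tor (fine n M) → ℂ :=
  Q1 n L M T' (g ∘ (sites n L M).symm)

omit [NeZero n] [NeZero L] hM in
/-- `(g ∘ sites⁻¹) ∘ sites = g`. [folklore] -/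
theorem comp_symm_comp (g : Tor (fine (n * L) M) → ℂ) : (g ∘ (sites n L M).symm) ∘ sites n L M = g := by
  funext x; simp

/-- **COMP⁺ IN TOWER SHAPE**: `Q_{T″} = Q_T ∘ Q₁` on level-`n·L` fields (the `hcomp` of `ub_tower`). [folklore] -/
theorem Qk_compT_eq_comp (T : Tor (fine n M) → ℂ) (T' : Tor (fine L (fine n M)) → ℂ) :
    Qk (n * L) M (compT n L M T T') = Qk n M T ∘ Q1tow n L M T' := by
  funext g
  have h := Qk_comp_Q1_apply n L M T T' (g ∘ (sites n L M).symm)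
  rw [comp_symm_comp] at h
  exact h.symm

/-- the level-`n·L` coarse form on transported phases is the fine form: `Sc (n·L) M (Rtr R′) g = Sf n L M R′ (g ∘ sites⁻¹)`. [folklore] -/
theorem Sc_Rtr_eq (R' : Tor (fine L (fine n M)) → Fin d → ℂ) (g : Tor (fine (n * L) M) → ℂ) :
    Sc (n * L) M (Rtr n L M R') g = Sf n L M R' (g ∘ (sites n L M).symm) := by
  rw [Sf_eq_transport, comp_symm_comp]

/-- the one-step block-spin value in tower shape: `blockSpin Q₁ (Sc (n·L) (Rtr R′)) f = blockSpin Q_{T′} (Sf R′) f` (the `hONE` slot of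
`ub_tower` reads the canonical-pair ONE⁺). [folklore] -/
theorem blockSpin_Q1tow (T' : Tor (fine L (fine n M)) → ℂ) (R' : Tor (fine L (fine n M)) → Fin d → ℂ) (f : Tor (fine n M) → ℂ) :
    blockSpin (Q1tow n L M T') (Sc (n * L) M (Rtr n L M R')) f = blockSpin (Q1 n L M T') (Sf n L M R') f := by
  refine blockSpin_equiv ((sites n L M).symm.arrowCongr (Equiv.refl ℂ)) (fun f' => ?_) (fun f' => ?_) f
  · have harr : (sites n L M).symm.arrowCongr (Equiv.refl ℂ) f' = f' ∘ sites n L M := by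
      funext x; simp [Equiv.arrowCongr_apply]
    rw [harr, Q1tow]
    congr 1
    funext y; simp
  · have harr : (sites n L M).symm.arrowCongr (Equiv.refl ℂ) f' = f' ∘ sites n L M := by
      funext x; simp [Equiv.arrowCongr_apply]
    rw [harr, Sf_eq_transport]

/-- leaf UB⁺'s shape passes between the presentations: a fine-level witness for the composite constraint IS a level-`n·L` coarse witness on
the composite/transported data, and conversely. [folklore] -/
theorem ub_transport {R' : Tor (fine L (fine n M)) → Fin d → ℂ} {T : Tor (fine n M) → ℂ} {T' : Tor (fine L (fine n M)) → ℂ} {Λ : ℝ}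
    {μ : Tor M → ℂ} :
    (∃ f', Qk n M T (Q1 n L M T' f') = μ ∧ Sf n L M R' f' ≤ Λ * nsq μ) ↔
      (∃ g, Qk (n * L) M (compT n L M T T') g = μ ∧ Sc (n * L) M (Rtr n L M R') g ≤ Λ * nsq μ) := by
  constructor
  · rintro ⟨f', hf', hb⟩
    refine ⟨f' ∘ sites n L M, ?_, ?_⟩
    · rw [← Qk_comp_Q1_apply]; exact hf'
    · rw [← Sf_eq_transport]; exact hb
  · rintro ⟨g, hg, hb⟩
    refine ⟨g ∘ (sites n L M).symm, ?_, ?_⟩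
    · have h := Qk_comp_Q1_apply n L M T T' (g ∘ (sites n L M).symm)
      rw [comp_symm_comp] at h
      rw [Function.comp_apply] at h
      rw [h]; exact hg
    · rw [← Sc_Rtr_eq]; exact hb

/-! ## §4 The k-indexed tower: `OneStepAveragedLaw` for the scalar covariant species modulo the per-level brackets -/

section Tower

variable (Rc : (k : ℕ) → Tor (fine (L ^ k) M) → Fin d → ℂ) (T : (k : ℕ) → Tor (fine (L ^ k) M) → ℂ)

omit [NeZero n] in
/-- **ROW NE2's WALL SHAPE FOR THE SCALAR COVARIANT SPECIES, MODULO THE PER-LEVEL BRACKETS**: along the tower `n_k = L^k` with data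
`(Rc k, T k)` (unimodular `T k`), leaf-P⁺-shaped coercivity at every level and the two one-sided additive brackets between the consecutive
block-spin values `Δ′_k(μ) = blockSpin (Q_{T_k}) Sc_k μ` ⟹ `OneStepAveragedLaw (fun _ ↦ 1) 1 (k ↦ X_k) (k ↦ max (e k) (e′ k))` for the
Hermitian effective operators `X_k = effSc (L^k) M (Rc k) (T k) a` on the unit torus.  Nothing of NE3. [folklore] -/
theorem oneStepAveragedLaw_effSc (hT : ∀ k x, ‖T k x‖ = 1) {CP : ℕ → ℝ}
    (hPc : ∀ k f, qW (L ^ k) M f ≤ CP k * (Sc (L ^ k) M (Rc k) f + nsq (Qk (L ^ k) M (T k) f)))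
    {a : ℝ} (ha : 0 < a) (e e' : ℕ → ℝ) (he : ∀ k, 0 ≤ e k)
    (hbr : ∀ k μ, blockSpin (Qk (L ^ k) M (T k)) (Sc (L ^ k) M (Rc k)) μ
        ≤ blockSpin (Qk (L ^ (k + 1)) M (T (k + 1))) (Sc (L ^ (k + 1)) M (Rc (k + 1))) μ + e k * nsq μ ∧
      blockSpin (Qk (L ^ (k + 1)) M (T (k + 1))) (Sc (L ^ (k + 1)) M (Rc (k + 1))) μ
        ≤ blockSpin (Qk (L ^ k) M (T k)) (Sc (L ^ k) M (Rc k)) μ + e' k * nsq μ) :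
    OneStepAveragedLaw (ι := fun _ => Tor M) (fun _ => (1 : Matrix (Tor M) (Tor M) ℂ)) 1
      (fun k => effSc (L ^ k) M (Rc k) (T k) a) (fun k => max (e k) (e' k)) := by
  refine oneStepAveragedLaw_of_forms _ (fun k => effSc_isHermitian (L ^ k) M (hT k) (hPc k) ha) _
    (fun k => (he k).trans (le_max_left _ _)) (fun k μ => ?_) (fun k μ => ?_)
  · rw [← blockSpin_Sc_eq (L ^ k) M (hT k) (hPc k) ha μ, ← blockSpin_Sc_eq (L ^ (k + 1)) M (hT (k + 1)) (hPc (k + 1)) ha μ]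
    have h := (hbr k μ).2
    have hn : e' k * nsq μ ≤ max (e k) (e' k) * ∑ i, ‖μ i‖ ^ 2 :=
      mul_le_mul_of_nonneg_right (le_max_right _ _) (nsq_nonneg μ)
    unfold nsq at h hn; linarith
  · rw [← blockSpin_Sc_eq (L ^ k) M (hT k) (hPc k) ha μ, ← blockSpin_Sc_eq (L ^ (k + 1)) M (hT (k + 1)) (hPc (k + 1)) ha μ]
    have h := (hbr k μ).1
    have hn : e k * nsq μ ≤ max (e k) (e' k) * ∑ i, ‖μ i‖ ^ 2 :=
      mul_le_mul_of_nonneg_right (le_max_left _ _) (nsq_nonneg μ)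
    unfold nsq at h hn; linarith

omit [NeZero n] in
/-- **… AND THE SPINE's η-RATE CURRENCY**: GEOMETRIC per-level brackets (`e k = e′ k = C·ρ^k`, `ρ < 1`) give
`TowerLimitRate (fun _ ↦ 1) 1 (k ↦ X_k) C ρ` — the effective operators `X_k = effSc (L^k) M (Rc k) (T k) a` CONVERGE on the unit torus with
`‖X_k − X_∞‖ ≤ C·ρ^k/(1 − ρ)` (`CovariantAveragingTower.towerLimitRate_of_oneStepAveragedLaw` with identity averagings; the route's target R of
the skeleton §0 for the scalar covariant species, MODULO the brackets). [folklore] -/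
theorem towerLimitRate_effSc (hT : ∀ k x, ‖T k x‖ = 1) {CP : ℕ → ℝ}
    (hPc : ∀ k f, qW (L ^ k) M f ≤ CP k * (Sc (L ^ k) M (Rc k) f + nsq (Qk (L ^ k) M (T k) f)))
    {a : ℝ} (ha : 0 < a) {C ρ : ℝ} (hC : 0 ≤ C) (hρ : 0 ≤ ρ) (hρ1 : ρ < 1)
    (hbr : ∀ k μ, blockSpin (Qk (L ^ k) M (T k)) (Sc (L ^ k) M (Rc k)) μ
        ≤ blockSpin (Qk (L ^ (k + 1)) M (T (k + 1))) (Sc (L ^ (k + 1)) M (Rc (k + 1))) μ + C * ρ ^ k * nsq μ ∧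
      blockSpin (Qk (L ^ (k + 1)) M (T (k + 1))) (Sc (L ^ (k + 1)) M (Rc (k + 1))) μ
        ≤ blockSpin (Qk (L ^ k) M (T k)) (Sc (L ^ k) M (Rc k)) μ + C * ρ ^ k * nsq μ) :
    TowerLimitRate (ι := fun _ => Tor M) (fun _ => (1 : Matrix (Tor M) (Tor M) ℂ)) 1
      (fun k => effSc (L ^ k) M (Rc k) (T k) a) C ρ := by
  have hlaw := oneStepAveragedLaw_effSc L M Rc T hT hPc ha (fun k => C * ρ ^ k) (fun k => C * ρ ^ k)
    (fun k => by positivity) hbr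
  simp only [max_self] at hlaw
  refine towerLimitRate_of_oneStepAveragedLaw _ one_pos (fun k => ?_) _ hρ1 hlaw
  rw [inv_one]
  calc ‖(1 : Matrix (Tor M) (Tor M) ℂ)‖ ^ 2 ≤ (1 : ℝ) ^ 2 :=
        pow_le_pow_left₀ (norm_nonneg _) (opNorm_one_le (ι := fun _ => Tor M) k) 2
    _ = 1 := one_pow 2

variable (R' : (k : ℕ) → Tor (fine L (fine (L ^ k) M)) → Fin d → ℂ) (T' : (k : ℕ) → Tor (fine L (fine (L ^ k) M)) → ℂ)

omit [NeZero n] in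
/-- **THE SAME FROM THE CANONICAL-PAIR BRACKETS** (`scalar_pair_bracket`'s conclusion shape at `n = L^k`) and the COMP⁺ data identities
(level `k+1`'s transports are the composite ones, its bond phases the fine ones read through `sites`; `L^(k+1) = L^k·L` by `rfl`):
`OneStepAveragedLaw (fun _ ↦ 1) 1 (k ↦ effSc (L^k) M (Rc k) (T k) a) (k ↦ max (e k) (e′ k))`. [folklore] -/
theorem oneStepAveragedLaw_effSc_of_pairs (hT : ∀ k x, ‖T k x‖ = 1) {CP : ℕ → ℝ}
    (hPc : ∀ k f, qW (L ^ k) M f ≤ CP k * (Sc (L ^ k) M (Rc k) f + nsq (Qk (L ^ k) M (T k) f)))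
    (hTcomp : ∀ k, T (k + 1) = compT (L ^ k) L M (T k) (T' k)) (hRtr : ∀ k, Rc (k + 1) = Rtr (L ^ k) L M (R' k))
    {a : ℝ} (ha : 0 < a) (e e' : ℕ → ℝ) (he : ∀ k, 0 ≤ e k)
    (hbr : ∀ k μ, blockSpin (Qk (L ^ k) M (T k)) (Sc (L ^ k) M (Rc k)) μ
        ≤ blockSpin (Qk (L ^ k) M (T k) ∘ Q1 (L ^ k) L M (T' k)) (Sf (L ^ k) L M (R' k)) μ + e k * nsq μ ∧
      blockSpin (Qk (L ^ k) M (T k) ∘ Q1 (L ^ k) L M (T' k)) (Sf (L ^ k) L M (R' k)) μ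
        ≤ blockSpin (Qk (L ^ k) M (T k)) (Sc (L ^ k) M (Rc k)) μ + e' k * nsq μ) :
    OneStepAveragedLaw (ι := fun _ => Tor M) (fun _ => (1 : Matrix (Tor M) (Tor M) ℂ)) 1
      (fun k => effSc (L ^ k) M (Rc k) (T k) a) (fun k => max (e k) (e' k)) := by
  refine oneStepAveragedLaw_effSc L M Rc T hT hPc ha e e' he fun k μ => ?_
  have hlev : blockSpin (Qk (L ^ (k + 1)) M (T (k + 1))) (Sc (L ^ (k + 1)) M (Rc (k + 1))) μ
      = blockSpin (Qk (L ^ k * L) M (compT (L ^ k) L M (T k) (T' k))) (Sc (L ^ k * L) M (Rtr (L ^ k) L M (R' k))) μ := by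
    rw [hTcomp k, hRtr k]; rfl
  rw [hlev]
  exact bracket_transport (L ^ k) L M (hbr k μ)

end Tower

end Summit.QuantumFields.BalabanUV.T4Continuum.VariationalCovariantTower

end
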